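import Summits.ResolutionOfSingularities.ResolutionOfSingularities.Theorems.UniversalCellsCampaignW82PrimeFieldReachOutside
import Literature.AlgebraicGeometry.Resolution.RegularDerivationQuotient
import Literature.AlgebraicGeometry.Resolution.DerivationCompletion
import Mathlib.FieldTheory.IntermediateField.Adjoin.Basic
import Mathlib.FieldTheory.PurelyInseparable.PerfectClosure
import Mathlib.FieldTheory.KummerPolynomial
import Mathlib.RingTheory.Derivation.Basic
import Mathlib.Algebra.Polynomial.Derivation
import Mathlib.Algebra.Polynomial.Expand
import HarnessLib

/-!
# [OURS · L1 W8.2] THE `p`-TH ROOT TOWER OF `t` OVER `M(t)`: derivations on its levels, and regularity of a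
# base change climbs the tower from the FIRST level on (Stacks 07PG)

Cell `res-hironaka` (run/shared/lean/pub/res-hironaka/), LADDER-RESOLUTION rung L (RESCUE), slot W8.2; host route
`UniversalCells`, host item `PrimeFieldToPerfect` (stmt-ResolutionOfSingularities-15233), door 1. Proofs file
(Theses-free, commutative algebra only), written by res-L1-s82-pv-1 (gen 5). Algebra for the REGULAR-TWIST
CRITERION of the sibling file `…RegularTwistCriterion.lean` (Cruxes/PrimeFieldToPerfect/KERNEL.md §2 (E3): over
`K = M(t)`, `M` perfect, a variety is smooth iff its Frobenius twist is regular — «`k^{1/p}`-regularity suffices»).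

Setting: `K = RatFunc M` (`M` any field of characteristic `p`), `L ⊇ K` a field, and a `p`-TH ROOT TOWER of `t = X`
in `L`: `θ : ℕ → L`, `θ 0 = t`, `θ (n+1) ^ p = θ n` (it exists as soon as `L` is perfect). The
levels are the simple extensions `Kₙ = K⟮θ n⟯ ⊆ L` (`K₀ = K`, `Kₙ = K(t^{1/pⁿ})`).

* `exists_derivation_adjoin_simple` — for `α` integral over `K` with `(minpoly K α)' = 0` (an inseparable
  element), the derivation `d/dX` of `K[X]` descends to a `K`-derivation `D` of `K⟮α⟯` with `D(α) = 1`
  (Mathlib `Derivation.liftOfSurjective` along `aeval α`).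
* `rootTower_not_mem_range`, `derivative_minpoly_rootTower` — for `n ≥ 1`, `θ n ∉ K` (as `t` is not a `p`-th power
  in `M(t)`, `pow_ne_X_ratFunc`), so `θ n` is purely inseparable and not separable over `K`, and its minimal polynomial
  has zero derivative; hence `exists_derivation_level` — **a `K`-derivation `∂ₙ` of `Kₙ` with `∂ₙ(θ n) = 1`** —
  and `pow_ne_gen_level`: `θ n` is not a `p`-th power in `Kₙ`, so `minpoly_{Kₙ}(θ (n+1)) = X^p − θ n`
  (`minpoly_level_succ`, Mathlib `X_pow_sub_C_irreducible_of_prime`).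
* `isRegularRing_tensor_level_succ`, **`isRegularRing_tensor_level_of_one`** — for ANY commutative `K`-algebra
  `B`: if `K₁ ⊗_K B` is a regular ring then so is `Kₙ ⊗_K B` for every `n ≥ 1`. The step `Kₙ → Kₙ₊₁ = Kₙ(θₙ^{1/p})`
  is the radical step of Stacks 07PR/07PG (tree: `isRegularRing_tensor_of_minpoly_eq_X_pow_sub_C`) fed by the
  derivation `∂ₙ ⊗ 1` of `Kₙ ⊗_K B` (tree: `tensorProductDerivation`), which takes `θ n ⊗ 1` to the unit `1`.
  THE FIRST STEP `K → K₁` IS NOT CLAIMED (no `K`-derivation of `K` moves `t`): it is exactly the hypothesis, and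
  in the sibling file exactly the content of «the Frobenius twist is regular».
* Sibling file `…RootTowerPerfect.lean`: for `M` PERFECT the tower exists in every perfect `L`, its union
  `K_∞ = K(θ₀, θ₁, …)` is perfect, and every finite subset of `K_∞` lies in one level `Kₙ`.

HONEST FRAMING. OURS lemmas (role replaced: §17 ¶2 p.89 l.59–62 of [Hironaka2017], typed AS PRINTED as
`S17Methodology.U89_3`); NOT statements of the manuscript; classical commutative algebra (Stacks 07PG; Matsumura
§26–§30), re-keyed to the slot's residual field `M(t)`. AI work, weaker than expert review; no claim beyond the kernel.
-/

noncomputable section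

set_option linter.dupNamespace false -- mandated namespace of this single-conjunct summit

open Polynomial TensorProduct IntermediateField
open Literature.AlgebraicGeometry.Resolution

namespace Summit.ResolutionOfSingularities.ResolutionOfSingularities.Theorems.CampaignW82

/-! ## §1 Derivations on inseparable simple extensions -/

/-- **`d/dX` descends to an inseparable simple extension.** If `α` is integral over `K` and the minimal polynomial
of `α` has zero derivative, there is a `K`-derivation `D` of `K⟮α⟯` with `D(α) = 1`: the ideal `(minpoly α)` of
`K[X]` is stable under `d/dX` up to the ideal, so `d/dX` descends along the surjection `aeval α : K[X] → K⟮α⟯`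
(Mathlib `Derivation.liftOfSurjective`). [folklore] -/
theorem exists_derivation_adjoin_simple {K E : Type*} [Field K] [Field E] [Algebra K E] {α : E}
    (hα : IsIntegral K α) (hder : derivative (minpoly K α) = 0) :
    ∃ D : Derivation K K⟮α⟯ K⟮α⟯, D (AdjoinSimple.gen K α) = 1 := by
  classical
  let f : K[X] →ₐ[K] K⟮α⟯ := aeval (AdjoinSimple.gen K α)
  have hf : Function.Surjective f := fun y => by
    obtain ⟨q, hq⟩ := (adjoin.powerBasis hα).exists_eq_aeval' y
    exact ⟨q, by rw [hq, adjoin.powerBasis_gen]⟩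
  have hfmin : f (minpoly K α) = 0 := aeval_gen_minpoly K α
  have hd : ∀ x, f x = 0 → f (derivative x) = 0 := by
    intro x hx
    have hdvd : minpoly K α ∣ x := by
      rw [← minpoly_gen K α]
      exact minpoly.dvd K _ hx
    obtain ⟨h, rfl⟩ := hdvd
    rw [derivative_mul, hder, zero_mul, zero_add, map_mul, hfmin, zero_mul]
  refine ⟨(derivative' : Derivation K K[X] K[X]).liftOfSurjective (f := f) hf hd, ?_⟩
  have hX : f X = AdjoinSimple.gen K α := aeval_X _
  rw [← hX, Derivation.liftOfSurjective_apply, derivative'_apply, derivative_X, map_one]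

/-- **An element which is purely inseparable but not rational over `K` is not separable** (its minimal polynomial
would make it both separable and purely inseparable over `K`, hence in `K`:
`separableClosure ⊓ perfectClosure = ⊥`). [folklore] -/
theorem not_isSeparable_of_pow_mem_range {K E : Type*} [Field K] [Field E] [Algebra K E] (p : ℕ)
    [ExpChar K p] {θ : E} {n : ℕ} (hn : θ ^ p ^ n ∈ (algebraMap K E).range)
    (hθ : θ ∉ Set.range (algebraMap K E)) : ¬ IsSeparable K θ := by
  intro hsep
  have hperf : θ ∈ perfectClosure K E := (mem_perfectClosure_iff_pow_mem p).mpr ⟨n, hn⟩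
  have hs : θ ∈ separableClosure K E := mem_separableClosure_iff.mpr hsep
  have hbot : θ ∈ (⊥ : IntermediateField K E) := by
    rw [← separableClosure_inf_perfectClosure K E]
    exact IntermediateField.mem_inf.mpr ⟨hs, hperf⟩
  exact hθ (IntermediateField.mem_bot.mp hbot)

/-- The minimal polynomial of a purely inseparable, non-rational element has zero derivative. [folklore] -/
theorem derivative_minpoly_eq_zero_of_pow_mem_range {K E : Type*} [Field K] [Field E] [Algebra K E] (p : ℕ)
    [ExpChar K p] {θ : E} (hint : IsIntegral K θ) {n : ℕ} (hn : θ ^ p ^ n ∈ (algebraMap K E).range)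
    (hθ : θ ∉ Set.range (algebraMap K E)) : derivative (minpoly K θ) = 0 := by
  have hns := not_isSeparable_of_pow_mem_range p hn hθ
  by_contra hne
  exact hns ((separable_iff_derivative_ne_zero (minpoly.irreducible hint)).mpr hne)

/-! ## §2 The root tower of `t` over `K = M(t)` -/

section Tower

variable {p : ℕ} [Fact p.Prime] {M : Type} [Field M] [CharP M p] {L : Type} [Field L]
  [Algebra (RatFunc M) L] (θ : ℕ → L) (hθ0 : θ 0 = algebraMap (RatFunc M) L RatFunc.X)
  (hθ : ∀ n, θ (n + 1) ^ p = θ n)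

include hθ0 hθ

omit [Fact p.Prime] [CharP M p] in
/-- `(θ n)^{pⁿ} = t`. [folklore] -/
theorem rootTower_pow (n : ℕ) : θ n ^ p ^ n = algebraMap (RatFunc M) L RatFunc.X := by
  induction n with
  | zero => rw [pow_zero, pow_one, hθ0]
  | succ n ih => rw [pow_succ', pow_mul, hθ, ih]

omit [CharP M p] in
/-- Every level root is integral over `K`: a root of `X^{pⁿ} − t`. [folklore] -/
theorem isIntegral_rootTower (n : ℕ) : IsIntegral (RatFunc M) (θ n) := by
  refine ⟨X ^ p ^ n - C RatFunc.X, monic_X_pow_sub_C _ (pow_ne_zero n (Fact.out : p.Prime).ne_zero), ?_⟩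
  rw [eval₂_sub, eval₂_X_pow, eval₂_C, rootTower_pow θ hθ0 hθ n, sub_self]

omit [CharP M p] in
/-- For `n ≥ 1` the level root `θ n` is NOT in `K`: otherwise `t` would be a `p`-th power in `M(t)`
(`pow_ne_X_ratFunc`). [folklore] -/
theorem rootTower_not_mem_range (n : ℕ) (hn : 1 ≤ n) : θ n ∉ Set.range (algebraMap (RatFunc M) L) := by
  rintro ⟨c, hc⟩
  have hp : p.Prime := Fact.out
  obtain ⟨m, rfl⟩ := Nat.exists_eq_add_of_le' hn
  have h1 : algebraMap (RatFunc M) L ((c ^ p ^ m) ^ p) = algebraMap (RatFunc M) L RatFunc.X := by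
    rw [← pow_mul, ← pow_succ, map_pow, hc, rootTower_pow θ hθ0 hθ (m + 1)]
  exact pow_ne_X_ratFunc hp.two_le M (c ^ p ^ m) ((algebraMap (RatFunc M) L).injective h1)

omit [Fact p.Prime] hθ0 in
/-- `(θ n)^{p^k} = θ (n - k)`-type bookkeeping: `θ (n + k) ^ p ^ k = θ n`. [folklore] -/
theorem rootTower_pow_add (n k : ℕ) : θ (n + k) ^ p ^ k = θ n := by
  induction k with
  | zero => rw [pow_zero, pow_one, add_zero]
  | succ k ih => rw [pow_succ', pow_mul, ← add_assoc, hθ, ih]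

/-- The minimal polynomial of `θ n`, `n ≥ 1`, has zero derivative (`θ n` is purely inseparable over `K` and not
in `K`). [folklore] -/
theorem derivative_minpoly_rootTower (n : ℕ) (hn : 1 ≤ n) :
    derivative (minpoly (RatFunc M) (θ n)) = 0 := by
  haveI : ExpChar (RatFunc M) p := ExpChar.prime (Fact.out : p.Prime)
  refine derivative_minpoly_eq_zero_of_pow_mem_range p (isIntegral_rootTower θ hθ0 hθ n) (n := n)
    ⟨RatFunc.X, (rootTower_pow θ hθ0 hθ n).symm⟩ (rootTower_not_mem_range θ hθ0 hθ n hn)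

/-- **The derivation of the level `Kₙ = K⟮θ n⟯`, `n ≥ 1`**: a `K`-derivation `∂ₙ` with `∂ₙ(θ n) = 1`.
[folklore] -/
theorem exists_derivation_level (n : ℕ) (hn : 1 ≤ n) :
    ∃ D : Derivation (RatFunc M) (RatFunc M)⟮θ n⟯ (RatFunc M)⟮θ n⟯, D (AdjoinSimple.gen (RatFunc M) (θ n)) = 1 :=
  exists_derivation_adjoin_simple (isIntegral_rootTower θ hθ0 hθ n) (derivative_minpoly_rootTower θ hθ0 hθ n hn)

/-- **`θ n` is not a `p`-th power in `Kₙ`** (`n ≥ 1`): `∂ₙ(c^p) = p c^{p-1} ∂ₙ c = 0 ≠ 1 = ∂ₙ(θ n)`.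
[folklore] -/
theorem pow_ne_gen_level (n : ℕ) (hn : 1 ≤ n) (c : (RatFunc M)⟮θ n⟯) :
    c ^ p ≠ AdjoinSimple.gen (RatFunc M) (θ n) := by
  intro hc
  have hp : p.Prime := Fact.out
  obtain ⟨D, hD⟩ := exists_derivation_level θ hθ0 hθ n hn
  haveI : CharP L p := charP_of_injective_algebraMap (algebraMap (RatFunc M) L).injective p
  haveI : CharP (RatFunc M)⟮θ n⟯ p :=
    (algebraMap (RatFunc M)⟮θ n⟯ L).charP (algebraMap (RatFunc M)⟮θ n⟯ L).injective p
  have h1 : D (c ^ p) = 0 := by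
    rw [Derivation.leibniz_pow, ← Nat.cast_smul_eq_nsmul ((RatFunc M)⟮θ n⟯) p, CharP.cast_eq_zero, zero_smul]
  rw [hc, hD] at h1
  exact one_ne_zero h1

omit [Fact p.Prime] [CharP M p] hθ0 in
/-- `Kₙ ≤ Kₙ₊₁` (`θ n = (θ (n+1))^p`). [folklore] -/
theorem level_le_succ (n : ℕ) : (RatFunc M)⟮θ n⟯ ≤ (RatFunc M)⟮θ (n + 1)⟯ := by
  rw [adjoin_simple_le_iff, ← hθ n]
  exact pow_mem (mem_adjoin_simple_self _ _) p

omit [Fact p.Prime] [CharP M p] hθ0 in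
/-- `Kₙ ≤ Kₘ` for `n ≤ m`. [folklore] -/
theorem level_mono {n m : ℕ} (hnm : n ≤ m) : (RatFunc M)⟮θ n⟯ ≤ (RatFunc M)⟮θ m⟯ := by
  obtain ⟨k, rfl⟩ := Nat.exists_eq_add_of_le hnm
  rw [adjoin_simple_le_iff, ← rootTower_pow_add θ hθ n k]
  exact pow_mem (mem_adjoin_simple_self _ _) _

/-- **The minimal polynomial over `Kₙ` of the next root is `X^p − θ n`** (`n ≥ 1`; irreducible by
`X_pow_sub_C_irreducible_of_prime` since `θ n` is not a `p`-th power in `Kₙ`). [folklore] -/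
theorem minpoly_level_succ (n : ℕ) (hn : 1 ≤ n) :
    minpoly (RatFunc M)⟮θ n⟯ (θ (n + 1)) = X ^ p - C (AdjoinSimple.gen (RatFunc M) (θ n)) := by
  have hp : p.Prime := Fact.out
  symm
  refine minpoly.eq_of_irreducible_of_monic
    (X_pow_sub_C_irreducible_of_prime hp (pow_ne_gen_level θ hθ0 hθ n hn)) ?_ (monic_X_pow_sub_C _ hp.ne_zero)
  rw [map_sub, map_pow, aeval_X, aeval_C, hθ n]
  exact sub_self _

end Tower

/-! ## §3 Regularity of a base change climbs the tower from level one -/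

section Climb

variable {p : ℕ} [Fact p.Prime] {M : Type} [Field M] [CharP M p] {L : Type} [Field L]
  [Algebra (RatFunc M) L] (θ : ℕ → L) (hθ0 : θ 0 = algebraMap (RatFunc M) L RatFunc.X)
  (hθ : ∀ n, θ (n + 1) ^ p = θ n)

include hθ0 hθ

/-- **One radical step up the tower** (Stacks 07PG/07PR): for a commutative `K`-algebra `B` and `n ≥ 1`, if
`Kₙ ⊗_K B` is a regular ring then so is `Kₙ₊₁ ⊗_K B ≅ (Kₙ ⊗_K B)[w]/(w^p − θ n ⊗ 1)`, the derivation
`∂ₙ ⊗ 1` taking `θ n ⊗ 1` to the unit `1`. [cite: StacksProject, Tag 07PG] -/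
theorem isRegularRing_tensor_level_succ (B : Type) [CommRing B] [Algebra (RatFunc M) B] (n : ℕ) (hn : 1 ≤ n)
    [IsRegularRing ((RatFunc M)⟮θ n⟯ ⊗[RatFunc M] B)] :
    IsRegularRing ((RatFunc M)⟮θ (n + 1)⟯ ⊗[RatFunc M] B) := by
  classical
  -- notation: `K = RatFunc M`, `Fn = K⟮θ n⟯ ≤ F' = K⟮θ (n+1)⟯`
  set Fn : IntermediateField (RatFunc M) L := (RatFunc M)⟮θ n⟯ with hFn
  set F' : IntermediateField (RatFunc M) L := (RatFunc M)⟮θ (n + 1)⟯ with hF'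
  have hle : Fn ≤ F' := level_le_succ θ hθ n
  letI : Algebra Fn F' := (IntermediateField.inclusion hle).toRingHom.toAlgebra
  haveI : IsScalarTower (RatFunc M) Fn F' := IsScalarTower.of_algebraMap_eq fun _ => rfl
  haveI : IsScalarTower Fn F' L := IsScalarTower.of_algebraMap_eq fun _ => rfl
  -- the generator `θ' = θ (n+1)` of `F'` and the constant `a = θ n` of `Fn`
  let a : Fn := AdjoinSimple.gen (RatFunc M) (θ n)
  let θ' : F' := AdjoinSimple.gen (RatFunc M) (θ (n + 1))
  have hθ'a : (θ' : F') ^ p = algebraMap Fn F' a := Subtype.ext (by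
    change θ (n + 1) ^ p = θ n
    exact hθ n)
  -- the minimal polynomial of `θ'` over `Fn`
  have hmin' : minpoly Fn (θ' : L) = X ^ p - C a := minpoly_level_succ θ hθ0 hθ n hn
  have hmin : minpoly Fn θ' = X ^ p - C a := by
    rw [← hmin', ← minpoly.algebraMap_eq (algebraMap F' L).injective θ']
    rfl
  have hint : IsIntegral Fn θ' := by
    refine ⟨X ^ p - C a, monic_X_pow_sub_C _ (Fact.out : p.Prime).ne_zero, ?_⟩
    rw [eval₂_sub, eval₂_X_pow, eval₂_C, hθ'a, sub_self]
  -- `F'` is generated by `θ'` over `Fn` (indeed over `K`)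
  have htop : IntermediateField.adjoin Fn {θ'} = ⊤ := by
    rw [eq_top_iff]
    intro y _
    obtain ⟨q, hq⟩ := (adjoin.powerBasis (isIntegral_rootTower θ hθ0 hθ (n + 1))).exists_eq_aeval' y
    rw [adjoin.powerBasis_gen] at hq
    have hy : y = aeval θ' (q.map (algebraMap (RatFunc M) Fn)) := by
      rw [aeval_map_algebraMap]; exact hq
    rw [hy]
    exact IntermediateField.algebra_adjoin_le_adjoin Fn _ (Polynomial.aeval_mem_adjoin_singleton Fn _)
  -- the derivation `∂ₙ ⊗ 1` of `Fn ⊗ B`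
  obtain ⟨Dn, hDn⟩ := exists_derivation_level θ hθ0 hθ n hn
  let dA0 : Derivation (RatFunc M) Fn (Fn ⊗[RatFunc M] B) := (Algebra.linearMap Fn (Fn ⊗[RatFunc M] B)).compDer Dn
  have hmul : ∀ x y : Fn, dA0.toLinearMap.toAddMonoidHom.toIntLinearMap (x * y) =
      x • dA0.toLinearMap.toAddMonoidHom.toIntLinearMap y + y • dA0.toLinearMap.toAddMonoidHom.toIntLinearMap x :=
    fun x y => dA0.leibniz x y
  let D₀ := tensorProductDerivation (R := RatFunc M) (A := Fn) (C := B)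
    (Derivation.mk' dA0.toLinearMap.toAddMonoidHom.toIntLinearMap hmul) 0 fun r => by
      rw [Derivation.coe_mk', AddMonoidHom.coe_toIntLinearMap, LinearMap.toAddMonoidHom_coe,
        Derivation.coeFn_coe, Derivation.map_algebraMap, Derivation.zero_apply, tmul_zero]
  -- the radical step (Stacks 07PG); the derivation is packed at the instance path of the lemma
  have key : ∃ D : Derivation ℤ (Fn ⊗[RatFunc M] B) (Fn ⊗[RatFunc M] B), D (a ⊗ₜ[RatFunc M] (1 : B)) = 1 := by
    refine ⟨D₀, ?_⟩
    change tensorProductDerivation _ _ _ (a ⊗ₜ[RatFunc M] (1 : B)) = 1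
    rw [tensorProductDerivation_tmul_one, Derivation.coe_mk', AddMonoidHom.coe_toIntLinearMap,
      LinearMap.toAddMonoidHom_coe, Derivation.coeFn_coe]
    change Algebra.linearMap Fn (Fn ⊗[RatFunc M] B) (Dn a) = 1
    rw [Algebra.linearMap_apply, hDn, map_one]
  obtain ⟨D, hD1⟩ := key
  have hD : IsUnit (D (a ⊗ₜ[RatFunc M] (1 : B))) := (congrArg IsUnit hD1).mpr isUnit_one
  -- `algebraMap Fn (Fn ⊗ B) a` unfolds to `a ⊗ₜ 1`; the instance paths agree up to unfolding
  exact isRegularRing_tensor_of_minpoly_eq_X_pow_sub_C (R := RatFunc M) (T := B) (F := Fn) hint htop hmin D hD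


/-- **Regularity of a base change climbs the whole tower from LEVEL ONE**: for a commutative `K`-algebra `B`,
if `K₁ ⊗_K B` is a regular ring then `Kₙ₊₁ ⊗_K B` is a regular ring for every `n`. (The step `K → K₁` is not
claimed.) [cite: StacksProject, Tag 07PG] -/
theorem isRegularRing_tensor_level_of_one (B : Type) [CommRing B] [Algebra (RatFunc M) B]
    (h1 : IsRegularRing ((RatFunc M)⟮θ 1⟯ ⊗[RatFunc M] B)) (n : ℕ) :
    IsRegularRing ((RatFunc M)⟮θ (n + 1)⟯ ⊗[RatFunc M] B) := by
  induction n with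
  | zero => exact h1
  | succ n ih =>
    haveI := ih
    exact isRegularRing_tensor_level_succ θ hθ0 hθ B (n + 1) le_add_self

end Climb

end Summit.ResolutionOfSingularities.ResolutionOfSingularities.Theorems.CampaignW82

end
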